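/-
Copyright (c) 2026 the pub-hodgecm-mathlib formalisation cell (harness21).  Prover seat hodgecm-mathlib-LH4-p09 (g8), req620 Track A «(D-RAM) FOUR-FRAME» squad
(heir LEAD F0P3a-plan (g20) T19-24 «STAGE-1b PRE-SCOPING BY IDLE HANDS: ALLOWED AS SCOPING»; dealer LH4-plan (g12) WORD #49 «(L-model-G)»; heir dealer LH4-plan (g13)).  2026-09-04.
-/
import Summits.HodgeConjecture.HodgeConjecture.Theorems.F0P3cDyRamLabelledGluedStratumRead    -- ★ p859257 (this seat): `latticeInLevel_diagonal_latt_G1_iff`; brings ★ B56 F1–F4, ★ (iv-a)∕(iv-b)∕(iv-c), ★ StratumTools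
import HarnessLib

/-!
# (D-RAM) four-frame, STAGE 1b scoping — unit (L-model-G) item (1) «where the mixed inequality CUTS the stratum»: the diagonal level token in
# `κ`-currency on the glued normal form, and the GENERIC CLASS-CUT ORBIT COUNT `Σ_{dualisable glued M, P(κ)} w = #{g ∈ R : P g} · |𝒯-orbit| · weight`

STAGE-1b SCOPING BRICK in the sense of heir LEAD F0P3a-plan (g20) T19-24 and dealer LH4-plan (g12) WORD #49 (unit «(L-model-G)», item (1): «where the mixed
inequality cuts the stratum, the honest sub-stratum census as the producer's TARGET»): `Theorems/` only, statement-first, ★-only imports, helper lane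
`--supports stmt-HodgeConjecture-24833 --as helper`; it PAYS NO tier-0 row and states no STAGE-1b law (count-neutral).

THE OBSERVATION.  On the glued normal form `V(x, ζ, y″) = (1 0 0; x ϖ^ρ 0; xζ+y″ ϖ^ρζ ϖ^{2ρ+s})` (`x, ζ` units) the only conjunct of the diagonal level token
`diag(e)·M ⊆ ϖ^ℓ·M` that sees the glue letters is `|xζ(e₂ − e₁) + (e₂ − e₀)y″| ≤ |ϖ|^{ℓ+2ρ+s}` (★ p859257), and
`xζ(e₂ − e₁) + (e₂ − e₀)y″ = (e₂ − e₀)·xζ·(κ + g_e)`, `κ = y″∕(xζ)`, `g_e = (e₂ − e₁)∕(e₂ − e₀)`: the token is a BALL CONDITION ON THE GLUE INVARIANT `κ`,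
`|κ + g_e| ≤ |ϖ|^{ℓ+2ρ+s}∕|e₂ − e₀|` — the same currency as ★ F3a's stability-on-the-foot `|κ + g₀| ≤ |ϖ|^{2ρ+2t−m}`, `g₀ = (β−1)∕(α−1)` (for the model token
`D₁ = diag(α−1, β−1, 0)` literally `g_e = g₀`).  Since `κ` is a depth-`(ρ+2t)` class invariant of the lattice and the dualisable glued family is the disjoint
union of the unit-torus orbits `𝒯·latt V(1, 1, g)` over the `F`-rational classes `g ∈ R` (★ (iv-a)∕(iv-c)), ANY class predicate `P` cuts the family orbit by
orbit, and the ★ B5 (iv) ∕ F3b orbit–stabiliser count goes through verbatim with `R` replaced by `{g ∈ R : P g}`.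

* §1 **`latticeInLevel_diagonal_latt_glued_iff_kappa`** — the token on `latt V(x, ζ, y″)` in `κ`-currency (`e₂ ≠ e₀`).
* §1 `tokenBall_class` — the ball condition `|e₂ − e₀|·|κ + g_e| ≤ |ϖ|^{ℓ+2ρ+s}` is a depth-`(ρ+s)` CLASS condition as soon as `|e₂ − e₀| ≤ |ϖ|^{ℓ+ρ}` (an
  outer conjunct of the token on the locus).
* §2 **`finsum_stabiliserWeight_glued_dualisable_sep_eq_ncard_mul`** — GENERIC CLASS-CUT ORBIT COUNT: for `s = 2t`, `ρ, t ≥ 1`, an irredundant complete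
  system `R` of the fixed elements of valuation `|ϖ|^{2t}` mod `𝔭^{ρ+2t}` (★ (iv-c)) and any predicate `P` on `K` constant on the depth-`(ρ+2t)` classes of such
  elements: `Σᶠ_{M = latt V(x,ζ,y″) dualisable, P(y″∕(xζ))} 1∕[𝒰 : S_F(M)] = #{g ∈ R : P g} · ((q−1)q^{ρ+2t−1})((q−1)q^{2ρ−1}) · (((q−1)q^{⌈(ρ+2t)∕2⌉−1})((q−1)q^{ρ−1}))⁻¹`
  (★ F3b `finsum_stabiliserWeight_glued_foot_eq_ncard_mul` is the case `P = (|· + g₀| ≤ |ϖ|^e)` with stability folded in).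
* §2 `orbit_mul_weight_eq` — the per-orbit constant is `q^{ρ + ⌊(ρ+2t)∕2⌋}`.
* §3 `glued_stable_sep_eq_of_depths` ∕ `glued_stable_sep_eq_kappa_of_foot` — the STABLE dualisable glued family cut by a `κ`-predicate `P` is the dualisable glued
  family cut by `P` (TUBE: stability automatic, ★ B5 (ii)) ∕ by `(|κ + g₀| ≤ |ϖ|^{2ρ+2t−m}) ∧ P` (FOOT: ★ F3a), ready for §2.

The heads (the on-locus census of the labelled G1 ∕ G2 ∕ G3 weights in closed form, trichotomy in `k = v(e₂ − e₀)`) are the next file.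

HONEST LABEL: scoping inventory; STAGE-1b tier-0 rows T₊∕T₋∕regular stay OPEN; HC_CM is proved only modulo the 7 printed citations (2 remaining named
inputs: hLiu418 = `stmt-HodgeConjecture-24832`, h413 = `stmt-HodgeConjecture-24833`) until rung 0 closes.

## References
* [Kottwitz1986BaseChangeUnits] R. E. Kottwitz, *Base change for unit elements of Hecke algebras*, Compositio Math. 60 (1986), §1 pp. 240–241 (lattice counts via torus orbits and stabilisers).
* [Rogawski1990] J. D. Rogawski, *Automorphic Representations of Unitary Groups in Three Variables*, Ann. of Math. Stud. 123 (1990), §4.9 Prop. 4.9.1 (a) p. 55.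
* [Serre1980Trees] J.-P. Serre, *Trees*, Springer (1980), Ch. II §1.1 (lattices, Hermite normal forms, the ultrametric inequality).
-/

set_option autoImplicit false

noncomputable section

namespace Summit.HodgeConjecture.HodgeConjecture.Cruxes.H413.F0P3cDyRamLabelledGluedClassCut

open Matrix WithZero
open Literature.NumberTheory.Automorphic Literature.NumberTheory.Automorphic.HermitianLattice
open Literature.NumberTheory.Automorphic.UnitaryLatticeTree Literature.NumberTheory.Automorphic.UnitaryThreeFourFrame
open Summit.HodgeConjecture.HodgeConjecture.Cruxes.H413.F0P3cDyRamDiagonalTorusDefs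
open Summit.HodgeConjecture.HodgeConjecture.Cruxes.H413.F0P3cDyRamDiagonalStrataDefs
open Summit.HodgeConjecture.HodgeConjecture.Cruxes.H413.F0P3cDyRamDiagonalGluedTorusOrbits
open Summit.HodgeConjecture.HodgeConjecture.Cruxes.H413.F0P3cDyRamDiagonalGluedStabiliserIndex (stabiliserWeight_latt_glued_tube_eq ne_zero_and_v_lt_one_of_v_eq_exp)
open Summit.HodgeConjecture.HodgeConjecture.Cruxes.H413.F0P3cDyRamDiagonalGluedStabiliserIndexFull (ncard_unitTorus_orbit_latt_glued_eq)
open Summit.HodgeConjecture.HodgeConjecture.Cruxes.H413.F0P3cDyRamDiagonalGluedStability (mapGL_latt_hnf_glued_eq_of_depths)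
open Summit.HodgeConjecture.HodgeConjecture.Cruxes.H413.F0P3cDyRamDiagonalGluedFootClasses (mapGL_latt_glued_eq_iff_kappa)
open Summit.HodgeConjecture.HodgeConjecture.Cruxes.H413.F0P3cDyRamDiagonalStratumTools (finsum_mem_eq_ncard_mul stabiliserWeight_mapGL_diagGLUnits)
open Summit.HodgeConjecture.HodgeConjecture.Cruxes.H413.F0P3cDyRamFourFrameCensusDefs
open Summit.HodgeConjecture.HodgeConjecture.Cruxes.H413.F0P3cDyRamLabelledGluedStratumRead
open scoped Valued WithZero Matrix MatrixGroups

/-! ## §1  The token in `κ`-currency on the glued normal form -/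

section Read

variable {K : Type*} [Field K] [Valued K ℤᵐ⁰]

/-- **THE DIAGONAL LEVEL TOKEN ON THE GLUED NORMAL FORM, IN `κ`-CURRENCY** (`|x| = |ζ| = 1`, `e₂ ≠ e₀`, `κ = y″∕(xζ)`, `g_e = (e₂ − e₁)∕(e₂ − e₀)`):
`diag(e)·latt V ⊆ ϖ^ℓ·latt V ⟺ [|eᵢ| ≤ |ϖ|^ℓ] ∧ |e₁ − e₀| ≤ |ϖ|^{ℓ+ρ} ∧ |e₂ − e₁| ≤ |ϖ|^{ℓ+ρ+s} ∧ |e₂ − e₀|·|κ + g_e| ≤ |ϖ|^{ℓ+2ρ+s}`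
(★ p859257 `latticeInLevel_diagonal_latt_G1_iff` and `xζ(e₂ − e₁) + (e₂ − e₀)y″ = (e₂ − e₀)·xζ·(κ + g_e)`). [cite: Kottwitz1986BaseChangeUnits, §1 pp. 240–241] -/
theorem latticeInLevel_diagonal_latt_glued_iff_kappa {ϖ : K} (hϖ : ϖ ≠ 0) (ℓ ρ s : ℕ) (e : Fin 3 → K) (he : e 2 ≠ e 0) {x ζ : K}
    (hx : Valued.v x = 1) (hζ : Valued.v ζ = 1) (y'' : K) :
    LatticeInLevel ϖ ℓ (Matrix.diagonal e) (latt (!![1, 0, 0; x, ϖ ^ ρ, 0; x * ζ + y'', ϖ ^ ρ * ζ, ϖ ^ (2 * ρ + s)] : Matrix (Fin 3) (Fin 3) K)) ↔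
      (Valued.v (e 0) ≤ Valued.v ϖ ^ ℓ ∧ Valued.v (e 1) ≤ Valued.v ϖ ^ ℓ ∧ Valued.v (e 2) ≤ Valued.v ϖ ^ ℓ) ∧
        Valued.v (e 1 - e 0) ≤ Valued.v ϖ ^ (ℓ + ρ) ∧ Valued.v (e 2 - e 1) ≤ Valued.v ϖ ^ (ℓ + ρ + s) ∧
          Valued.v (e 2 - e 0) * Valued.v (y'' / (x * ζ) + (e 2 - e 1) / (e 2 - e 0)) ≤ Valued.v ϖ ^ (ℓ + 2 * ρ + s) := by
  have hx0 : x ≠ 0 := fun h0 => by rw [h0, map_zero] at hx; exact zero_ne_one hx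
  have hζ0 : ζ ≠ 0 := fun h0 => by rw [h0, map_zero] at hζ; exact zero_ne_one hζ
  have he0 : e 2 - e 0 ≠ 0 := sub_ne_zero.2 he
  have hfac : x * ζ * (e 2 - e 1) + (e 2 - e 0) * y'' = (e 2 - e 0) * (x * ζ) * (y'' / (x * ζ) + (e 2 - e 1) / (e 2 - e 0)) := by
    field_simp
    ring
  rw [latticeInLevel_diagonal_latt_G1_iff hϖ ℓ ρ s e hx hζ y'', hfac]
  simp only [map_mul, hx, hζ, mul_one]

/-- **THE TOKEN BALL IS A CLASS CONDITION**: if `a ≤ |ϖ|^{ℓ+ρ}` (`a = |e₂ − e₀|`) then `a·|κ + g_e| ≤ |ϖ|^{ℓ+2ρ+s}` depends on `κ` only through its class modulo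
`𝔭^{ρ+s}` (ultrametric: `|κ′ + g_e| ≤ max(|κ + g_e|, |κ′ − κ|)` and `a·|ϖ|^{ρ+s} ≤ |ϖ|^{ℓ+2ρ+s}`). [cite: Serre1980Trees, II §1.1] -/
theorem tokenBall_class {ϖ g : K} {a : ℤᵐ⁰} {ℓ ρ s : ℕ} (ha : a ≤ Valued.v ϖ ^ (ℓ + ρ)) {κ κ' : K}
    (hκκ : Valued.v (κ' - κ) ≤ Valued.v ϖ ^ (ρ + s)) (hκ : a * Valued.v (κ + g) ≤ Valued.v ϖ ^ (ℓ + 2 * ρ + s)) :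
    a * Valued.v (κ' + g) ≤ Valued.v ϖ ^ (ℓ + 2 * ρ + s) := by
  rw [show κ' + g = (κ + g) + (κ' - κ) by ring]
  refine (mul_le_mul' le_rfl (Valuation.map_add _ _ _)).trans ?_
  rw [mul_max]
  refine max_le hκ ?_
  rw [show ℓ + 2 * ρ + s = (ℓ + ρ) + (ρ + s) by ring, pow_add]
  exact mul_le_mul' ha hκκ

end Read

/-! ## §2  The generic class-cut orbit count -/

section Count

variable {K : Type*} [Field K] [Valued K ℤᵐ⁰]

/-- **GENERIC CLASS-CUT ORBIT COUNT** (`ρ, t ≥ 1`, ramified quadratic letters, trace bound, finite residue field; `R` an irredundant complete system of the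
`σ`-fixed elements of valuation `|ϖ|^{2t}` modulo `𝔭^{ρ+2t}`; `P` any predicate on `K` which passes from an element of valuation `|ϖ|^{2t}` to everything in
its depth-`(ρ+2t)` class): the dualisable glued lattices `latt V(x, ζ, y″)` whose glue invariant `κ = y″∕(xζ)` satisfies `P` are the disjoint union of the
unit-torus orbits `𝒯·latt V(1, 1, g)` over `{g ∈ R : P g}` (★ (iv-a): `κ` is exactly `𝒯`-invariant, every member of the orbit of `V(1,1,g)` has `κ = g`, every
dualisable glued lattice with `κ` in the class of `g` is in that orbit), each orbit has `((q−1)q^{ρ+2t−1})((q−1)q^{2ρ−1})` members (★ (iv-b-idx)) of the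
common weight `(((q−1)q^{⌈(ρ+2t)∕2⌉−1})((q−1)q^{ρ−1}))⁻¹` (★ B5 (iii)); hence the weighted count. [cite: Kottwitz1986BaseChangeUnits, §1 pp. 240–241]
[cite: Rogawski1990, §4.9 Prop. 4.9.1 (a) p. 55] -/
theorem finsum_stabiliserWeight_glued_dualisable_sep_eq_ncard_mul {σ : K →+* K} (hσ : ∀ a, σ (σ a) = a) (hvσ : ∀ a, Valued.v (σ a) = Valued.v a)
    (hfix : ∀ x : K, σ x = x → x ≠ 0 → ∃ n : ℤ, Valued.v x = exp (2 * n)) {ϖ : K} (hϖ : Valued.v ϖ = exp (-1 : ℤ))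
    {d : ℕ} (hd : Valued.v (ϖ - σ ϖ) = Valued.v ϖ ^ d) [Finite 𝓀[K]] (hTr : ∀ a : K, Valued.v (a + σ a) ≤ Valued.v ϖ * Valued.v a)
    (ρ t : ℕ) (hρ : 1 ≤ ρ) (ht : 1 ≤ t) {R : Set K} (hRfin : R.Finite)
    (hR1 : ∀ g ∈ R, σ g = g ∧ Valued.v g = Valued.v ϖ ^ (2 * t))
    (hR2 : ∀ f : K, σ f = f → Valued.v f = Valued.v ϖ ^ (2 * t) → ∃ g ∈ R, Valued.v (f - g) ≤ Valued.v ϖ ^ (ρ + 2 * t))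
    (hR3 : ∀ g ∈ R, ∀ g' ∈ R, Valued.v (g - g') ≤ Valued.v ϖ ^ (ρ + 2 * t) → g = g')
    (P : K → Prop) (hP : ∀ κ g : K, Valued.v g = Valued.v ϖ ^ (2 * t) → Valued.v (κ - g) ≤ Valued.v ϖ ^ (ρ + 2 * t) → P κ → P g) :
    ∑ᶠ M ∈ {M : Submodule 𝒪[K] (Fin 3 → K) | ∃ x ζ y'' : K, Valued.v x = 1 ∧ Valued.v ζ = 1 ∧ Valued.v y'' = Valued.v ϖ ^ (2 * t) ∧
        M = latt (!![1, 0, 0; x, ϖ ^ ρ, 0; x * ζ + y'', ϖ ^ ρ * ζ, ϖ ^ (2 * ρ + 2 * t)] : Matrix (Fin 3) (Fin 3) K) ∧ IsDualisableLattice σ ϖ M ∧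
        P (y'' / (x * ζ))}, stabiliserWeight σ M =
      ({g ∈ R | P g}.ncard : ℚ) *
        ((((Nat.card 𝓀[K] - 1) * Nat.card 𝓀[K] ^ (ρ + 2 * t - 1)) * ((Nat.card 𝓀[K] - 1) * Nat.card 𝓀[K] ^ (2 * ρ - 1)) : ℕ) : ℚ) *
        ((((Nat.card 𝓀[K] - 1) * Nat.card 𝓀[K] ^ ((ρ + 2 * t + 1) / 2 - 1)) * ((Nat.card 𝓀[K] - 1) * Nat.card 𝓀[K] ^ (ρ - 1)) : ℕ) : ℚ)⁻¹ := by
  classical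
  obtain ⟨hϖ0, hϖ1⟩ := ne_zero_and_v_lt_one_of_v_eq_exp hϖ
  have hpρ : ϖ ^ ρ ≠ 0 := pow_ne_zero ρ hϖ0
  have hpr : ϖ ^ (2 * ρ + 2 * t) ≠ 0 := pow_ne_zero _ hϖ0
  -- reference lattices `V₀(g) = V(1, 1, g)` and their orbits
  choose V₀ hV₀ using fun g : K => exists_gl_coe_eq_glued (1 : K) 1 g hpρ hpr
  set Orb : K → Set (Submodule 𝒪[K] (Fin 3 → K)) := fun g => {M | ∃ u ∈ unitTorus K 3, M = mapGL (diagGLUnits u) (latt (V₀ g : Matrix (Fin 3) (Fin 3) K))}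
    with hOrb
  set R' : Set K := {g ∈ R | P g} with hR'
  have hvg : ∀ g ∈ R, Valued.v g < 1 := fun g hg => by
    rw [(hR1 g hg).2]; exact pow_lt_one₀ zero_le hϖ1 (by omega)
  have hlt : Valued.v ϖ ^ (ρ + 2 * t) < Valued.v ϖ ^ (2 * t) := by
    rw [pow_add, mul_comm]
    exact mul_lt_of_lt_one_right (pow_pos ((Valuation.pos_iff _).2 hϖ0) _) (pow_lt_one₀ zero_le hϖ1 (by omega))
  have h11 : Valued.v (1 : K) = 1 := map_one _
  -- §2a: the set identity
  have hset : {M : Submodule 𝒪[K] (Fin 3 → K) | ∃ x ζ y'' : K, Valued.v x = 1 ∧ Valued.v ζ = 1 ∧ Valued.v y'' = Valued.v ϖ ^ (2 * t) ∧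
        M = latt (!![1, 0, 0; x, ϖ ^ ρ, 0; x * ζ + y'', ϖ ^ ρ * ζ, ϖ ^ (2 * ρ + 2 * t)] : Matrix (Fin 3) (Fin 3) K) ∧ IsDualisableLattice σ ϖ M ∧
        P (y'' / (x * ζ))} = ⋃ g ∈ R', Orb g := by
    ext M
    simp only [Set.mem_setOf_eq, Set.mem_iUnion, hOrb, hR', exists_prop]
    constructor
    · rintro ⟨x, ζ, y'', hx, hζ, hy'', rfl, hdual, hPκ⟩
      obtain ⟨V, hV⟩ := exists_gl_coe_eq_glued x ζ y'' hpρ hpr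
      rw [← hV] at hdual
      obtain ⟨f, hσf, hκf⟩ := (isDualisableLattice_latt_glued_iff_exists_fixed_kappa hσ hvσ hϖ0 hϖ1 hTr ρ t hρ ht hx hζ hy'' V hV).1 hdual
      have hvκ : Valued.v (y'' / (x * ζ)) = Valued.v ϖ ^ (2 * t) := by rw [map_div₀, map_mul, hx, hζ, mul_one, div_one, hy'']
      have hvf : Valued.v f = Valued.v ϖ ^ (2 * t) := by
        have h := Valuation.map_sub_eq_of_lt_left Valued.v (hvκ ▸ hκf.trans_lt hlt : Valued.v (y'' / (x * ζ) - f) < Valued.v (y'' / (x * ζ)))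
        rw [← hvκ, ← h, sub_sub_cancel]
      obtain ⟨g, hg, hfg⟩ := hR2 f hσf hvf
      have hκg : Valued.v (y'' / (x * ζ) - g) ≤ Valued.v ϖ ^ (ρ + 2 * t) := by
        rw [show y'' / (x * ζ) - g = (y'' / (x * ζ) - f) + (f - g) by ring]
        exact Valuation.map_add_le _ hκf hfg
      obtain ⟨u, hu, hM⟩ := exists_mem_unitTorus_latt_glued_eq_mapGL hϖ0 ρ t hx hζ hy'' ht hϖ1 (hvg g hg) hκg (V₀ g) (hV₀ g)
      exact ⟨g, ⟨hg, hP _ _ (hR1 g hg).2 hκg hPκ⟩, u, hu, hM⟩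
    · rintro ⟨g, ⟨hg, hPg⟩, u, hu, rfl⟩
      obtain ⟨x', ζ', y₁, hx', hζ', hy₁, hκ, hM⟩ := exists_glued_of_mem_orbit u hu g (ϖ ^ ρ) (ϖ ^ (2 * ρ + 2 * t)) (V₀ g) (hV₀ g)
      have hy₁' : Valued.v y₁ = Valued.v ϖ ^ (2 * t) := by rw [hy₁, (hR1 g hg).2]
      obtain ⟨V, hV⟩ := exists_gl_coe_eq_glued x' ζ' y₁ hpρ hpr
      refine ⟨x', ζ', y₁, hx', hζ', hy₁', hM, ?_, by rw [hκ]; exact hPg⟩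
      rw [hM, ← hV]
      exact (isDualisableLattice_latt_glued_iff_exists_fixed_kappa hσ hvσ hϖ0 hϖ1 hTr ρ t hρ ht hx' hζ' hy₁' V hV).2
        ⟨g, (hR1 g hg).1, by rw [hκ, sub_self, map_zero]; exact zero_le⟩
  -- §2b: pairwise disjoint
  have hdisj : R'.PairwiseDisjoint Orb := by
    intro g hg g' hg' hne
    rw [Function.onFun, Set.disjoint_left]
    intro M hM hM'
    apply hne
    simp only [hOrb, Set.mem_setOf_eq] at hM hM'
    obtain ⟨u, hu, rfl⟩ := hM
    obtain ⟨u', hu', hMM⟩ := hM'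
    obtain ⟨x, ζ, y, hx, hζ, hy, hκ, h1⟩ := exists_glued_of_mem_orbit u hu g (ϖ ^ ρ) (ϖ ^ (2 * ρ + 2 * t)) (V₀ g) (hV₀ g)
    obtain ⟨x', ζ', y', hx', hζ', -, hκ', h2⟩ := exists_glued_of_mem_orbit u' hu' g' (ϖ ^ ρ) (ϖ ^ (2 * ρ + 2 * t)) (V₀ g') (hV₀ g')
    have hyv : Valued.v y = Valued.v ϖ ^ (2 * t) := by rw [hy, (hR1 g hg.1).2]
    have hv := v_kappa_sub_le_of_latt_glued_eq hϖ0 hϖ1.le ρ t hx hζ hyv hx' hζ' (h1.symm.trans (hMM.trans h2))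
    rw [hκ, hκ'] at hv
    exact hR3 g hg.1 g' hg'.1 hv
  -- §2c: orbit sizes and the (constant) weight
  have hN : ∀ g ∈ R', (Orb g).ncard = ((Nat.card 𝓀[K] - 1) * Nat.card 𝓀[K] ^ (ρ + 2 * t - 1)) * ((Nat.card 𝓀[K] - 1) * Nat.card 𝓀[K] ^ (2 * ρ - 1)) :=
    fun g hg => ncard_unitTorus_orbit_latt_glued_eq hϖ hρ (2 * t) h11 h11 (by rw [(hR1 g hg.1).2]) (V₀ g) (by rw [hV₀ g])
  have hq : 1 < Nat.card 𝓀[K] := Finite.one_lt_card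
  have hN0 : ((Nat.card 𝓀[K] - 1) * Nat.card 𝓀[K] ^ (ρ + 2 * t - 1)) * ((Nat.card 𝓀[K] - 1) * Nat.card 𝓀[K] ^ (2 * ρ - 1)) ≠ 0 :=
    mul_ne_zero (mul_ne_zero (by omega) (pow_ne_zero _ (by omega))) (mul_ne_zero (by omega) (pow_ne_zero _ (by omega)))
  have hfinOrb : ∀ g ∈ R', (Orb g).Finite := fun g hg => Set.finite_of_ncard_ne_zero (by rw [hN g hg]; exact hN0)
  have hw : ∀ g ∈ R', ∀ M ∈ Orb g, stabiliserWeight σ M =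
      ((((Nat.card 𝓀[K] - 1) * Nat.card 𝓀[K] ^ ((ρ + 2 * t + 1) / 2 - 1)) * ((Nat.card 𝓀[K] - 1) * Nat.card 𝓀[K] ^ (ρ - 1)) : ℕ) : ℚ)⁻¹ := by
    rintro g hg M ⟨u, -, rfl⟩
    rw [stabiliserWeight_mapGL_diagGLUnits]
    exact stabiliserWeight_latt_glued_tube_eq hσ hvσ hfix hϖ hd hρ t h11 h11 (hR1 g hg.1).2 (V₀ g) (hV₀ g) (hR1 g hg.1).1
      (by rw [map_one, (hR1 g hg.1).1, one_mul, sub_self, map_zero]; exact zero_le)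
  have hR'fin : R'.Finite := hRfin.subset (Set.sep_subset _ _)
  rw [hset, finsum_mem_biUnion hdisj hR'fin hfinOrb,
    finsum_mem_congr rfl (fun g hg => finsum_mem_eq_ncard_mul (hfinOrb g hg) _ _ (hw g hg)),
    finsum_mem_congr rfl (fun g hg => by rw [hN g hg]), finsum_mem_eq_ncard_mul hR'fin _ _ (fun g _ => rfl)]
  ring

/-- **THE PER-ORBIT CONSTANT** `|𝒯-orbit| · weight = q^{ρ + ⌊(ρ+2t)∕2⌋}` (`q ≥ 2`, `ρ ≥ 1`). [cite: Kottwitz1986BaseChangeUnits, §1 pp. 240–241] -/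
theorem orbit_mul_weight_eq {q : ℕ} (hq : 1 < q) {ρ : ℕ} (hρ : 1 ≤ ρ) (t : ℕ) :
    ((((q - 1) * q ^ (ρ + 2 * t - 1)) * ((q - 1) * q ^ (2 * ρ - 1)) : ℕ) : ℚ) *
        ((((q - 1) * q ^ ((ρ + 2 * t + 1) / 2 - 1)) * ((q - 1) * q ^ (ρ - 1)) : ℕ) : ℚ)⁻¹ = (q : ℚ) ^ (ρ + (ρ + 2 * t) / 2) := by
  have hq1 : ((q : ℚ) - 1) ≠ 0 := sub_ne_zero.2 (by exact_mod_cast hq.ne')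
  have hq0 : (q : ℚ) ≠ 0 := by exact_mod_cast (by omega : q ≠ 0)
  have hA : ρ + 2 * t - 1 + (2 * ρ - 1) = (ρ + (ρ + 2 * t) / 2) + (((ρ + 2 * t + 1) / 2 - 1) + (ρ - 1)) := by omega
  push_cast [Nat.cast_sub hq.le]
  rw [show ((q : ℚ) - 1) * (q : ℚ) ^ (ρ + 2 * t - 1) * (((q : ℚ) - 1) * (q : ℚ) ^ (2 * ρ - 1)) =
      ((q : ℚ) - 1) ^ 2 * (q : ℚ) ^ (ρ + 2 * t - 1 + (2 * ρ - 1)) by ring, hA]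
  field_simp
  ring

end Count

/-! ## §3  Folding the stability conjunct: tube and foot -/

section Stable

variable {K : Type*} [Field K] [Valued K ℤᵐ⁰]

/-- **ON THE TUBE** (`2ρ + s ≤ n₁`, `2ρ ≤ n₂`, `ρ ≤ n₃`) stability is automatic (★ B5 (ii) `mapGL_latt_hnf_glued_eq_of_depths`), so the stable dualisable glued
family cut by a condition `Q` on the glue letters is the dualisable glued family cut by `Q`. [cite: Kottwitz1986BaseChangeUnits, §1 pp. 240–241] -/
theorem glued_stable_sep_eq_of_depths (σ : K →+* K) {ϖ : K} (hϖ0 : ϖ ≠ 0) (hϖ1 : Valued.v ϖ ≤ 1) {α β : K} (hα : Valued.v α = 1) (hβ : Valued.v β = 1)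
    (T : GL (Fin 3) K) (hT : (T : Matrix (Fin 3) (Fin 3) K) = Matrix.diagonal ![α, β, 1]) {n₁ n₂ n₃ : ℕ}
    (h₁ : Valued.v (β - 1) = Valued.v ϖ ^ n₁) (h₂ : Valued.v (α - 1) = Valued.v ϖ ^ n₂) (h₃ : Valued.v (β - α) = Valued.v ϖ ^ n₃)
    (ρ s : ℕ) (hρ₁ : 2 * ρ + s ≤ n₁) (hρ₂ : 2 * ρ ≤ n₂) (hρ₃ : ρ ≤ n₃) (Q : K → K → K → Prop) :
    {M : Submodule 𝒪[K] (Fin 3 → K) | ∃ x ζ y'' : K, Valued.v x = 1 ∧ Valued.v ζ = 1 ∧ Valued.v y'' = Valued.v ϖ ^ s ∧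
        M = latt (!![1, 0, 0; x, ϖ ^ ρ, 0; x * ζ + y'', ϖ ^ ρ * ζ, ϖ ^ (2 * ρ + s)] : Matrix (Fin 3) (Fin 3) K) ∧ mapGL T M = M ∧
        IsDualisableLattice σ ϖ M ∧ Q x ζ y''} =
      {M | ∃ x ζ y'' : K, Valued.v x = 1 ∧ Valued.v ζ = 1 ∧ Valued.v y'' = Valued.v ϖ ^ s ∧
        M = latt (!![1, 0, 0; x, ϖ ^ ρ, 0; x * ζ + y'', ϖ ^ ρ * ζ, ϖ ^ (2 * ρ + s)] : Matrix (Fin 3) (Fin 3) K) ∧ IsDualisableLattice σ ϖ M ∧ Q x ζ y''} := by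
  ext M
  constructor
  · rintro ⟨x, ζ, y'', hx, hζ, hy, hM, -, hdual, hQ⟩
    exact ⟨x, ζ, y'', hx, hζ, hy, hM, hdual, hQ⟩
  · rintro ⟨x, ζ, y'', hx, hζ, hy, hM, hdual, hQ⟩
    obtain ⟨V, hV⟩ := exists_gl_coe_eq_glued x ζ y'' (pow_ne_zero ρ hϖ0) (pow_ne_zero (2 * ρ + s) hϖ0)
    refine ⟨x, ζ, y'', hx, hζ, hy, hM, ?_, hdual, hQ⟩
    rw [hM, ← hV]
    exact mapGL_latt_hnf_glued_eq_of_depths hϖ0 hϖ1 hα hβ T hT h₁ h₂ h₃ ρ s hρ₁ hρ₂ hρ₃ hx hζ hy V hV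

/-- **ON THE GLUE FOOT** (`|β−1| = |ϖ|^{m+2t}`, `|α−1| = |β−α| = |ϖ|^m`, `ρ ≤ m ≤ 2ρ+2t`) stability is the ball `|κ + (β−1)∕(α−1)| ≤ |ϖ|^{2ρ+2t−m}` (★ F3a
`mapGL_latt_glued_eq_iff_kappa`), so the stable dualisable glued family cut by a `κ`-condition `P` is the dualisable glued family cut by `ball ∧ P`.
[cite: Kottwitz1986BaseChangeUnits, §1 pp. 240–241] -/
theorem glued_stable_sep_eq_kappa_of_foot (σ : K →+* K) {ϖ : K} (hϖ : Valued.v ϖ = exp (-1 : ℤ)) {α β : K} (hα : Valued.v α = 1) (hβ : Valued.v β = 1)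
    (T : GL (Fin 3) K) (hT : (T : Matrix (Fin 3) (Fin 3) K) = Matrix.diagonal ![α, β, 1]) {m t : ℕ}
    (h₁ : Valued.v (β - 1) = Valued.v ϖ ^ (m + 2 * t)) (h₂ : Valued.v (α - 1) = Valued.v ϖ ^ m) (h₃ : Valued.v (β - α) = Valued.v ϖ ^ m)
    {ρ : ℕ} (hρm : ρ ≤ m) (hm : m ≤ 2 * ρ + 2 * t) (P : K → Prop) :
    {M : Submodule 𝒪[K] (Fin 3 → K) | ∃ x ζ y'' : K, Valued.v x = 1 ∧ Valued.v ζ = 1 ∧ Valued.v y'' = Valued.v ϖ ^ (2 * t) ∧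
        M = latt (!![1, 0, 0; x, ϖ ^ ρ, 0; x * ζ + y'', ϖ ^ ρ * ζ, ϖ ^ (2 * ρ + 2 * t)] : Matrix (Fin 3) (Fin 3) K) ∧ mapGL T M = M ∧
        IsDualisableLattice σ ϖ M ∧ P (y'' / (x * ζ))} =
      {M | ∃ x ζ y'' : K, Valued.v x = 1 ∧ Valued.v ζ = 1 ∧ Valued.v y'' = Valued.v ϖ ^ (2 * t) ∧
        M = latt (!![1, 0, 0; x, ϖ ^ ρ, 0; x * ζ + y'', ϖ ^ ρ * ζ, ϖ ^ (2 * ρ + 2 * t)] : Matrix (Fin 3) (Fin 3) K) ∧ IsDualisableLattice σ ϖ M ∧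
        (Valued.v (y'' / (x * ζ) + (β - 1) / (α - 1)) ≤ Valued.v ϖ ^ (2 * ρ + 2 * t - m) ∧ P (y'' / (x * ζ)))} := by
  obtain ⟨hϖ0, -⟩ := ne_zero_and_v_lt_one_of_v_eq_exp hϖ
  ext M
  constructor
  · rintro ⟨x, ζ, y'', hx, hζ, hy, hM, hstab, hdual, hP⟩
    obtain ⟨V, hV⟩ := exists_gl_coe_eq_glued x ζ y'' (pow_ne_zero ρ hϖ0) (pow_ne_zero (2 * ρ + 2 * t) hϖ0)
    refine ⟨x, ζ, y'', hx, hζ, hy, hM, hdual, ?_, hP⟩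
    rw [hM, ← hV] at hstab
    exact (mapGL_latt_glued_eq_iff_kappa hϖ hα hβ T hT h₁ h₂ h₃ hρm hm hx hζ V hV).1 hstab
  · rintro ⟨x, ζ, y'', hx, hζ, hy, hM, hdual, hball, hP⟩
    obtain ⟨V, hV⟩ := exists_gl_coe_eq_glued x ζ y'' (pow_ne_zero ρ hϖ0) (pow_ne_zero (2 * ρ + 2 * t) hϖ0)
    refine ⟨x, ζ, y'', hx, hζ, hy, hM, ?_, hdual, hP⟩
    rw [hM, ← hV]
    exact (mapGL_latt_glued_eq_iff_kappa hϖ hα hβ T hT h₁ h₂ h₃ hρm hm hx hζ V hV).2 hball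

end Stable

end Summit.HodgeConjecture.HodgeConjecture.Cruxes.H413.F0P3cDyRamLabelledGluedClassCut

end
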